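import Summits.ABC.IUTFork.Cor312PinnedRegionsThreePins
import Summits.ABC.IUTFork.Thm311MultiradProofs
import HarnessLib

/-!
# Joshi ↔ [IUTchIII] Thm 3.11 / Cor 3.12 DICTIONARY (block E, rung LADDER-ABC:A2.E) — v0 SIGNATURE SKETCH (abc-iut-E-plan)

The ONLY place where Joshi's objects (Construction of Arithmetic Teichmüller Spaces I–IV, arXiv:2106.11452,
2303.01662v3, 2401.13508v4, 2403.10430v2 — unrefereed preprints, cited as such) are bound to OUR frozen typing of
[IUTchIII] Theorem 3.11 (`Thm311.LatticeSituation`, tensor packets, (Ind1)/(Ind2) families, `R^LGP`) and to the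
target `S := Cor312Vol.PilotKummerIndRelated S P ρ qK` (Cor312PinnedRegionsThreePins l.145).
The structure `Dictionary` carries DATA ONLY; every compatibility Joshi asserts, and every dictionary reading of ours,
is a separate `def … : Prop` — a CANDIDATE HYPOTHESIS with its arXiv sentence — never an axiom, instance, `sorry`
or Literature fact. «disputed» below is the registered HarnessLib status word recording that a dispute exists in
print (Mochizuki, Report on the recent series of preprints by K. Joshi, 2024-03); it takes no side.
FRAMING: this campaign LOCATES / CONDITIONALLY VERIFIES; NO abc claim; no side taken on [IUTchIII] Cor. 3.12 or on
any author; typed ≠ proved; typed AS A CANDIDATE ≠ endorsed; establishment = our kernel check only.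
-/

namespace Summit.ABC.IUTFork.Joshi

open Thm311 Cor312 Cor312Vol

variable {T : ThetaIndex} (S : LatticeSituation T) (P : Cor312.Setting S.toSituation)
  (ρ : (∀ v : T.V, v ∈ T.Vbad → Set (S.L.StarPacket v)) → ∀ (j : T.Label) (vQ : T.VQ), Set (S.L.Packet j vQ))
  (qK : ∀ v : T.V, v ∈ T.Vbad → Set (S.L.StarPacket v))

/-- **The dictionary datum** (DATA ONLY). `Pt` = Mochizuki's Adelic Ansatz `Σ̃_{L′}` as an abstract type of points
`z` ([J-III] Def. 4.2.2, p.31 l.51–81); `Move` = Joshi's indeterminacy / collation moves ([J-III] §8.11 «Mochizuki's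
Indeterminacies … à la Joshi»: his Ind1 = automorphisms of `G ↷ B^{φ=p}`, his Ind2 = change of point `y ∈ 𝒴`
(«ℚ_p-linear isomorphisms σ : Ĝ_m(O_{C♭}) → Ĝ_m(O_{C♭})», p.91 l.35–50; [J-I] Thm. th:main3 / Cor. co:action),
his Ind3 = log-Kummer shift; and the collation isomorphisms of [J-III] Prop. 9.7.5.1, p.112 l.40–60: «the images of ξ_{y,a}
… under all (topological) isomorphisms H^1_e(arith(L′)_y, ℤ(1)) ≃ H^1_e(arith(L′)_{y₀}, ℤ(1)) given by [Joshi, 2023a,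
Proposition 7.4.1]») acting on `Pt` by `act` ([J-III] Thm. 4.2.2.1 (1)–(3): `Σ̃_{L′}`
is stable); `base` = the Ansatz point carrying the line's Θ-pilot (row D-02: «Mochizuki's Ansatz is the set of
Θ^{gau}-links», [J-III] §4.2.3); `std` = the standard point `z_Θ = (y_1,…,y_{ℓ*}) ∈ Σ̃_{L′}`, `y_{ℓ*} = y′_0` ([J-III] §4.5 p.36 l.11–17 «which one
may think of as a standard Θ-Link»; `y′_0` = the standard point of `𝒴′_{L′}`, §4.4 p.35 l.24–, Prop. 4.4.1 p.35 l.99–); `datum z` = the Kummer datum in `∏_{j ∈ 𝔽_ℓ^⋇}` of the tensor packets at `v ∈ V^bad` realising the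
admissible lift `Ξ_z` ([J-III] §6.10.1 «the elements Ξ_z as Mochizuki's Θ-pilot objects»; §9.5–9.7 evaluation in
log-shells, Bloch–Kato logarithm) — row D-03; `real g` = the family of packet automorphisms by which the move `g`
acts on the tensor-packet codomain `I_Mochizuki` ([J-III] §9.4, Rosetta Stone Fragment 5 = §8.11.3) — rows D-04/D-10.
No property is asserted by this structure. -/
structure Dictionary where
  /-- points of Mochizuki's Adelic Ansatz `Σ̃_{L′}` ([J-III] Def. 4.2.2) -/
  Pt : Type
  /-- Joshi's indeterminacy and collation moves ([J-III] §8.11 p.91–93, Prop. 9.7.5.1 p.112 l.40–60) -/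
  Move : Type
  /-- the action of moves on Ansatz points ([J-III] Thm. 4.2.2.1) -/
  act : Move → Pt → Pt
  /-- the Ansatz point of the line's Θ-pilot (row D-02) -/
  base : Pt
  /-- the standard point `z_Θ` ([J-III] §4.5 p.36 l.11–17) -/
  std : Pt
  /-- realisation of `Ξ_z` as a Kummer datum in the star packets at bad places (row D-03) -/
  datum : Pt → ∀ v : T.V, v ∈ T.Vbad → Set (S.L.StarPacket v)
  /-- realisation of a move as a family of tensor-packet automorphisms (rows D-04/D-10) -/
  real : Move → S.L.PacketAut

variable {S P}
variable (𝔇 : Dictionary S)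

/-- **D-02/D-03 anchoring (OUR READING of [J-III] §6.10.1, p.53):** at the base point Joshi's datum IS the line's
Θ-pilot splitting-monoid datum `(S.D P.n).Ψ` of the typed Thm. 3.11 (i)(b). Candidate hypothesis, never asserted. [claim: Joshi2024ATS3, status: disputed] -/
@[claim "Joshi2024ATS3" "disputed"]
def BaseIsThetaPilot : Prop := 𝔇.datum 𝔇.base = (S.D P.n).Ψ

/-- **Rosetta Stone Fragment 5, typed ([J-III] §8.11.3, Table p.93; §8.11.2 «canonical interpretation»):** every
Joshi move is realised by a family of packet automorphisms lying in the subgroup generated by OUR frozen (Ind1) and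
(Ind2) families. This is the load-bearing half of Y1: Joshi's Ind2 RESCALES valuations ([J-I] §10 dilatation
example; [J-IIp] Thm. 6.9.1 `v_{K_j}(p) = j²·v_{K_1}(p)`), so at an instantiation whose `LogShells.ism` consists of
isometries this Prop is expected to FAIL — a LOCATION, not a verdict. Candidate hypothesis asserted (as a
correspondence) in print; never asserted here. The universal quantifier over `𝔇.Move` deliberately covers ALL of Joshi's moves — his Ind1/Ind2 σ-moves, his Ind3 (standard point `y_0` vs `ϕ(y_0)`, Frobenius orbit) and the collation isomorphisms of Prop. 9.7.5.1 — this is the intended, pinned reading (E-ref R1).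
[claim: Joshi2024ATS3, status: disputed] -/
@[claim "Joshi2024ATS3" "disputed"]
def MovesAreInd : Prop := ∀ g : 𝔇.Move, 𝔇.real g ∈ Subgroup.closure (S.L.Ind1Family ∪ S.L.Ind2Family)

/-- **Collation is equivariant (OUR READING of [J-III] §6.4 «collation, lifting» and Prop. 9.7.5.1 p.112 l.40–60; the set Θ̃^I_Mochizuki of
Thm.-Def. 9.8.1.1 p.113 l.67– is built from exactly these images):** the datum of a
moved point is the transport of the datum along the realising packet automorphisms. Candidate hypothesis. [claim: Joshi2024ATS3, status: disputed] -/
@[claim "Joshi2024ATS3" "disputed"]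
def DatumEquivariant : Prop :=
  ∀ (g : 𝔇.Move) (z : 𝔇.Pt) (v : T.V) (hv : v ∈ T.Vbad),
    𝔇.datum (𝔇.act g z) v hv = S.L.starAut (𝔇.real g) v '' 𝔇.datum z v hv

/-- **The standard point is an indeterminacy-translate of the base point (OUR READING of [J-III] Thm. 4.2.2.1 +
§8.11 «Ind2 = change of point y ∈ 𝒴»):** `z_Θ` is reached from `base` by finitely many moves. Candidate hypothesis. [claim: Joshi2024ATS3, status: disputed] -/
@[claim "Joshi2024ATS3" "disputed"]
def StdReachable : Prop := ∃ gs : List 𝔇.Move, gs.foldr 𝔇.act 𝔇.base = 𝔇.std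

/-- **Y1 `AnsatzWithinInd`** — the consequence the test consumes: up to `ρ`, the standard-point datum is one of the
POSSIBLE IMAGES `D′.Ψ`, `D′ ∈ ^{n,∘}R^{LGP}`, of the typed Thm. 3.11. Follows from `BaseIsThetaPilot ∧ MovesAreInd ∧
DatumEquivariant ∧ StdReachable` (`ansatzWithinInd_of_moves`). Candidate hypothesis. [claim: Joshi2024ATS3, status: disputed] -/
@[claim "Joshi2024ATS3" "disputed"]
def AnsatzWithinInd : Prop :=
  ∃ D' ∈ S.RLGP P.n, ∀ (j : T.Label) (vQ : T.VQ), ρ (𝔇.datum 𝔇.std) j vQ = ρ D'.Ψ j vQ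

/-- **Y2 `StandardPointIsQPilot` (region form; typed from [J-III] proof of Thm. 7.3.1, p.56 l.29–37 «the theta values
at the standard point have the size of q_w^{1/2ℓ}» — OUR GLOSS of the size display, not a printed sentence (E-ref R2) —, §6.10.1):** up to `ρ`, the standard-point datum is the q-pilot
Kummer datum `qK`. As a REGION identity this is stronger than the SIZE statement printed — E-ref grades it; the
size form is `StandardPointHasQPilotVolume`. Candidate hypothesis asserted (in size form) in print. [claim: Joshi2024ATS3, status: disputed] -/
@[claim "Joshi2024ATS3" "disputed"]
def StandardPointIsQPilot : Prop := ∀ (j : T.Label) (vQ : T.VQ), ρ (𝔇.datum 𝔇.std) j vQ = ρ qK j vQ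

/-- **Y2 (size form, FAITHFUL candidate):** in every packet the `ρ`-image of the standard-point datum has
procession-normalised log-volume at least the q-pilot's local contribution `P.qLocal j vQ` ([J-III] p.56 l.29–37;
[J-IIp] Thm. 9.2.1 for one prime). Bears on `P.Statement` through the volume route, NOT on S (E-PLAN R2). [claim: Joshi2024ATS3, status: disputed] -/
@[claim "Joshi2024ATS3" "disputed"]
def StandardPointHasQPilotVolume : Prop :=
  ∀ (j : T.Label) (vQ : T.VQ), P.qLocal j vQ ≤ (S.D P.n).logvol j vQ (ρ (𝔇.datum 𝔇.std) j vQ)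

/-! ## The test skeleton X-01: Y1 → Y2 → S (logic only) -/

/-- **X-01 (FILLS-MODULO-Y skeleton).** Kernel glue only: no Joshi claim and no clause of Cor. 3.12 is asserted. -/
theorem pilotKummerIndRelated_of_ansatzWithinInd (h1 : AnsatzWithinInd ρ 𝔇 (P := P))
    (h2 : StandardPointIsQPilot ρ qK 𝔇) : PilotKummerIndRelated S P ρ qK := by
  intro j vQ
  obtain ⟨D', hD', hEq⟩ := h1
  exact ⟨D', hD', (h2 j vQ).symm.trans (hEq j vQ)⟩

/-- Transport of the base datum along a list of moves stays among the possible images. -/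
theorem datum_foldr_mem (hB : BaseIsThetaPilot 𝔇 (P := P)) (hM : MovesAreInd 𝔇) (hE : DatumEquivariant 𝔇)
    (gs : List 𝔇.Move) :
    ∃ D' ∈ S.RLGP P.n, 𝔇.datum (gs.foldr 𝔇.act 𝔇.base) = D'.Ψ := by
  induction gs with
  | nil => exact ⟨S.D P.n, MRData.mem_RLGP_self _, by simpa [BaseIsThetaPilot] using hB⟩
  | cons g gs ih =>
      obtain ⟨D', hD', hEq⟩ := ih
      refine ⟨D'.map (𝔇.real g), ?_, ?_⟩
      · have h1 : D'.map (𝔇.real g) ∈ D'.RLGP := MRData.map_mem_RLGP D' (hM g)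
        have h2 : D'.RLGP = (S.D P.n).RLGP :=
          (MRData.RLGP_eq_iff _ _).2 (Relation.EqvGen.symm _ _ hD')
        simpa [Situation.RLGP, h2] using h1
      · funext v hv
        simp only [List.foldr_cons]
        rw [hE g _ v hv, hEq]
        rfl

/-- **Y1 from its components** (the dictionary's internal logic; kernel glue only). -/
theorem ansatzWithinInd_of_moves (hB : BaseIsThetaPilot 𝔇 (P := P)) (hM : MovesAreInd 𝔇)
    (hE : DatumEquivariant 𝔇) (hR : StdReachable 𝔇) : AnsatzWithinInd ρ 𝔇 (P := P) := by
  obtain ⟨gs, hgs⟩ := hR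
  obtain ⟨D', hD', hEq⟩ := datum_foldr_mem 𝔇 hB hM hE gs
  exact ⟨D', hD', fun j vQ => by rw [← hgs, hEq]⟩

end Summit.ABC.IUTFork.Joshi
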